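import Literature.Computability.AlgebraicComplexity.SpectrumSupportEstimate
import Literature.Computability.AlgebraicComplexity.KroneckerPowMarginals
import Literature.Computability.AlgebraicComplexity.WeightedEntropyMax
import HarnessLib

/-!
# The quantum functional is at most the upper support functional (CVZ Thm. 3.34): proof

Topic: `Literature/Computability/AlgebraicComplexity`. This file discharges the named fact
`ChristandlVranaZuiddam2023_le_upperSupportFunctional` of `QuantumFunctionals.lean`
(M. Christandl, P. Vrana, J. Zuiddam, *Universal points in the asymptotic spectrum of tensors*,
J. Amer. Math. Soc. 36 (2023) = arXiv:1709.07851v3, Thm. 3.34 with Thm. 3.24/3.30): for every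
`θ ∈ P([3])` and every complex 3-tensor `t`, `E_θ(t) ≤ ρ^θ(t)` and `F_θ(t) ≤ ζ^θ(t)`, where
`E_θ = logQuantumFunctional θ` is the (lower) logarithmic quantum functional (Def. 3.16, a supremum of
`θ`-weighted marginal von Neumann entropies over `GL × GL × GL`) and `ρ^θ = logUpperSupportFunctional θ`
is Strassen's logarithmic upper support functional (Def. 2.3, an infimum over bases of the maximal
`θ`-weighted marginal Shannon entropy of a distribution on the support).

## The printed proof and the proof given here

CVZ prove `ρ^θ ≥ E^θ` (Thm. 3.34) for the *upper* quantum functional `E^θ` defined through the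
isotypic projectors `P_λ` of Schur–Weyl duality on `V^{⊗n}` (Def. 3.3), by expanding `t^{⊗n}` over
type classes and using the majorisation property of highest weights (Rem. 3.33), and separately
`E^θ ≥ E_θ` (Thm. 3.24) by Keyl–Werner spectrum estimation (Thm. 3.27) and the gentle measurement lemma.
None of that representation theory is in Mathlib. The proof below establishes the same inequality
`E_θ ≤ ρ^θ` by an elementary route with the same skeleton (tensor powers, type classes, an entropy
count) in which the isotypic projectors are replaced by the orthogonal projections onto the
*commutant spans* `𝒲(L)` of `PermutationCommutant.lean` and spectrum estimation by the trace estimate of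
`SpectrumSupportEstimate.lean`:

* `quantumEntropy_actTensor_le_maxWeightedEntropy` — **the core inequality**: for `s ≠ 0` and any
  matrices `A, B, C`, `H_θ((A ⊗ B ⊗ C)·s) ≤ H_θ(supp s) = max_{P ∈ P(supp s)} H_θ(P)`.
  Suppose not, with gap `ε > 0`, and let `cⱼ` be the marginal entropies of `x = (A ⊗ B ⊗ C)·s`. Every
  nonzero entry of `s^{⊗n}` is indexed by a word triple whose empirical distribution lies in `P(supp s)`
  (`weightedEntropy_empirical`), so one of its legs has empirical entropy `≤ cⱼ - ε`
  (`exists_low_leg`): `s^{⊗n} = S₁ + S₂ + S₃` with `Sⱼ` supported on words low in leg `j`. Applying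
  `A^{⊗n} ⊗ B^{⊗n} ⊗ C^{⊗n}` (`kroneckerPow_actTensor_powMat`) gives `x^{⊗n} = X₁ + X₂ + X₃` where the leg-`j`
  columns of `Xⱼ` lie in `𝒲(Lⱼ)` (`col_mem_commutantSpan₁/₂/₃`), hence are fixed by the projection `Pⱼ`
  onto it; the three-leg union bound (`tensorNormSq_le_sum_three_legs`) gives
  `‖x‖^{2n} ≤ ∑ⱼ tr(Pⱼ ρⱼ(x)^{⊗n})`, while `trace_proj_powMat_le` makes each term `≤ ‖x‖^{2n}/4` for
  large `n` — a contradiction.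
* `logQuantumFunctional_le_logUpperSupportFunctional` — `E_θ(t) ≤ ρ^θ(t)`: apply the core inequality to
  `s = h·t` and `g h⁻¹` for all `g, h ∈ GL³`; `quantumFunctional_le_upperSupportFunctional` by
  monotonicity of `2^x`; and the discharge `ChristandlVranaZuiddam2023_le_upperSupportFunctional_holds`.

No definitions are introduced. Source: CVZ 2023, Def. 2.3, Def. 3.16, Thm. 3.24, Rem. 3.33, Thm. 3.34
(pp. 14–17 of the arXiv version).
-/

noncomputable section

open scoped BigOperators Matrix ComplexOrder

namespace Literature.Computability.AlgebraicComplexity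

/-! ## Empirical distributions of word triples -/

section Empirical

variable {ι κ μ : Type*} [Fintype ι] [Fintype κ] [Fintype μ] [DecidableEq ι] [DecidableEq κ]
  [DecidableEq μ] {n : ℕ}

omit [Fintype ι] in
/-- Summing the joint type over two coordinates gives the type of the remaining leg (leg 1).
[folklore] -/
theorem sum_sum_letterCount_triple₁ (u : Fin n → ι) (v : Fin n → κ) (w : Fin n → μ) (a : ι) :
    ∑ b, ∑ c, letterCount (fun m => (u m, v m, w m)) (a, b, c) = letterCount u a := by
  rw [letterCount_apply, Finset.card_eq_sum_card_fiberwise (f := fun m => (v m, w m))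
    (s := Finset.univ.filter fun m => u m = a) (t := Finset.univ) fun _ _ => Finset.mem_coe.2
    (Finset.mem_univ _), Fintype.sum_prod_type]
  refine Finset.sum_congr rfl fun b _ => Finset.sum_congr rfl fun c _ => ?_
  rw [letterCount_apply, Finset.filter_filter]
  congr 1
  ext m
  simp only [Finset.mem_filter, Finset.mem_univ, true_and, Prod.mk.injEq]

omit [Fintype κ] in
/-- Summing the joint type over two coordinates gives the type of the remaining leg (leg 2).
[folklore] -/
theorem sum_sum_letterCount_triple₂ (u : Fin n → ι) (v : Fin n → κ) (w : Fin n → μ) (b : κ) :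
    ∑ a, ∑ c, letterCount (fun m => (u m, v m, w m)) (a, b, c) = letterCount v b := by
  rw [letterCount_apply, Finset.card_eq_sum_card_fiberwise (f := fun m => (u m, w m))
    (s := Finset.univ.filter fun m => v m = b) (t := Finset.univ) fun _ _ => Finset.mem_coe.2
    (Finset.mem_univ _), Fintype.sum_prod_type]
  refine Finset.sum_congr rfl fun a _ => Finset.sum_congr rfl fun c _ => ?_
  rw [letterCount_apply, Finset.filter_filter]
  congr 1
  ext m
  simp only [Finset.mem_filter, Finset.mem_univ, true_and, Prod.mk.injEq]
  tauto

omit [Fintype μ] in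
/-- Summing the joint type over two coordinates gives the type of the remaining leg (leg 3).
[folklore] -/
theorem sum_sum_letterCount_triple₃ (u : Fin n → ι) (v : Fin n → κ) (w : Fin n → μ) (c : μ) :
    ∑ a, ∑ b, letterCount (fun m => (u m, v m, w m)) (a, b, c) = letterCount w c := by
  rw [letterCount_apply, Finset.card_eq_sum_card_fiberwise (f := fun m => (u m, v m))
    (s := Finset.univ.filter fun m => w m = c) (t := Finset.univ) fun _ _ => Finset.mem_coe.2
    (Finset.mem_univ _), Fintype.sum_prod_type]
  refine Finset.sum_congr rfl fun a _ => Finset.sum_congr rfl fun b _ => ?_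
  rw [letterCount_apply, Finset.filter_filter]
  congr 1
  ext m
  simp only [Finset.mem_filter, Finset.mem_univ, true_and, Prod.mk.injEq]
  tauto

/-- The **empirical distribution** `p ↦ #{m | (uₘ, vₘ, wₘ) = p} / n` of a word triple of length
`n ≥ 1` is a probability distribution. [folklore] -/
theorem empirical_mem_stdSimplex (hn : 0 < n) (u : Fin n → ι) (v : Fin n → κ) (w : Fin n → μ) :
    (fun p : ι × κ × μ => (letterCount (fun m => (u m, v m, w m)) p : ℝ) / n) ∈
      stdSimplex ℝ (ι × κ × μ) := by
  refine ⟨fun p => div_nonneg (Nat.cast_nonneg _) (Nat.cast_nonneg _), ?_⟩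
  rw [← Finset.sum_div, div_eq_one_iff_eq (by exact_mod_cast hn.ne' : (n : ℝ) ≠ 0)]
  exact_mod_cast sum_letterCount (fun m => (u m, v m, w m))

omit [Fintype ι] [Fintype κ] [Fintype μ] in
/-- The empirical distribution is supported on the letters that occur. [folklore] -/
theorem support_empirical_subset {Φ : Set (ι × κ × μ)} {u : Fin n → ι} {v : Fin n → κ} {w : Fin n → μ}
    (h : ∀ m, (u m, v m, w m) ∈ Φ) :
    Function.support (fun p : ι × κ × μ => (letterCount (fun m => (u m, v m, w m)) p : ℝ) / n) ⊆ Φ := by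
  intro p hp
  rw [Function.mem_support] at hp
  have hc : letterCount (fun m => (u m, v m, w m)) p ≠ 0 := by
    intro h0
    apply hp
    simp [h0]
  obtain ⟨m, hm⟩ := Finset.card_pos.1 (Nat.pos_of_ne_zero hc)
  have hm' : (u m, v m, w m) = p := (Finset.mem_filter.1 hm).2
  rw [← hm']
  exact h m

/-- The marginals of the empirical distribution are the empirical distributions of the legs, hence
`H_θ(empirical) = θ₁ H(type u / n) + θ₂ H(type v / n) + θ₃ H(type w / n)`. [folklore] -/
theorem weightedEntropy_empirical (θ : Fin 3 → ℝ) (u : Fin n → ι) (v : Fin n → κ) (w : Fin n → μ) :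
    weightedEntropy θ (fun p : ι × κ × μ => (letterCount (fun m => (u m, v m, w m)) p : ℝ) / n) =
      θ 0 * shannonEntropy (fun i => (letterCount u i : ℝ) / n) +
        θ 1 * shannonEntropy (fun i => (letterCount v i : ℝ) / n) +
        θ 2 * shannonEntropy (fun i => (letterCount w i : ℝ) / n) := by
  have h₁ : marginalDist₁ (fun p : ι × κ × μ => (letterCount (fun m => (u m, v m, w m)) p : ℝ) / n) =
      fun i => (letterCount u i : ℝ) / n := by
    funext a
    simp only [marginalDist₁, ← Finset.sum_div]
    rw [← sum_sum_letterCount_triple₁ u v w a]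
    push_cast
    rfl
  have h₂ : marginalDist₂ (fun p : ι × κ × μ => (letterCount (fun m => (u m, v m, w m)) p : ℝ) / n) =
      fun i => (letterCount v i : ℝ) / n := by
    funext b
    simp only [marginalDist₂, ← Finset.sum_div]
    rw [← sum_sum_letterCount_triple₂ u v w b]
    push_cast
    rfl
  have h₃ : marginalDist₃ (fun p : ι × κ × μ => (letterCount (fun m => (u m, v m, w m)) p : ℝ) / n) =
      fun i => (letterCount w i : ℝ) / n := by
    funext c
    simp only [marginalDist₃, ← Finset.sum_div]
    rw [← sum_sum_letterCount_triple₃ u v w c]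
    push_cast
    rfl
  rw [weightedEntropy, h₁, h₂, h₃]

end Empirical

/-! ## One of the three legs is low -/

section LowLeg

/-- If a `θ`-average of three numbers falls short of the `θ`-average of three others by `ε`, then one of
them falls short of its counterpart by `ε` (`θ` a probability vector). [folklore] -/
theorem exists_low_leg {θ : Fin 3 → ℝ} (hθ : θ ∈ stdSimplex ℝ (Fin 3)) {H₁ H₂ H₃ c₁ c₂ c₃ ε : ℝ}
    (h : θ 0 * H₁ + θ 1 * H₂ + θ 2 * H₃ ≤ θ 0 * c₁ + θ 1 * c₂ + θ 2 * c₃ - ε) :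
    H₁ ≤ c₁ - ε ∨ H₂ ≤ c₂ - ε ∨ H₃ ≤ c₃ - ε := by
  by_contra hcon
  push Not at hcon
  obtain ⟨k₁, k₂, k₃⟩ := hcon
  have hsum : θ 0 + θ 1 + θ 2 = 1 := by
    have := hθ.2
    simpa [Fin.sum_univ_three] using this
  have h0 := hθ.1 0
  have h1 := hθ.1 1
  have h2 := hθ.1 2
  have i₁ : θ 0 * c₁ - θ 0 * ε ≤ θ 0 * H₁ := by nlinarith
  have i₂ : θ 1 * c₂ - θ 1 * ε ≤ θ 1 * H₂ := by nlinarith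
  have i₃ : θ 2 * c₃ - θ 2 * ε ≤ θ 2 * H₃ := by nlinarith
  have hεθ : θ 0 * ε + θ 1 * ε + θ 2 * ε = ε := by
    rw [← add_mul, ← add_mul, hsum, one_mul]
  -- one of the weights is positive, and there the inequality is strict
  rcases lt_or_ge 0 (θ 0) with p0 | p0
  · have s₁ : θ 0 * c₁ - θ 0 * ε < θ 0 * H₁ := by nlinarith
    linarith
  rcases lt_or_ge 0 (θ 1) with p1 | p1
  · have s₂ : θ 1 * c₂ - θ 1 * ε < θ 1 * H₂ := by nlinarith
    linarith
  have e0 : θ 0 = 0 := le_antisymm p0 h0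
  have e1 : θ 1 = 0 := le_antisymm p1 h1
  have p2 : 0 < θ 2 := by linarith
  have s₃ : θ 2 * c₃ - θ 2 * ε < θ 2 * H₃ := by nlinarith
  linarith

end LowLeg

/-! ## Columns of an acted tensor with low support lie in the commutant span -/

section Columns

variable {ι κ μ ι' κ' μ' : Type*} [Fintype ι] [Fintype κ] [Fintype μ] {n : ℕ}

/-- The action is additive in the tensor. [folklore] -/
theorem actTensor_tensor_add {K : Type*} [CommSemiring K] (A : Matrix ι' ι K) (B : Matrix κ' κ K)
    (C : Matrix μ' μ K) (s t : ι → κ → μ → K) :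
    actTensor A B C (s + t) = actTensor A B C s + actTensor A B C t := by
  funext a b c
  simp only [actTensor_apply, Pi.add_apply, mul_add, Finset.sum_add_distrib]

/-- **Leg 1**: if `S` is supported on word triples whose first word lies in `L`, then every leg-1
column of `(A^{⊗n} ⊗ B' ⊗ C')·S` lies in `𝒲(L)`. [folklore] -/
theorem col_mem_commutantSpan₁ [Fintype ι'] [DecidableEq ι] [DecidableEq ι'] (A : Matrix ι' ι ℂ)
    (B' : Matrix (Fin n → κ') (Fin n → κ) ℂ)
    (C' : Matrix (Fin n → μ') (Fin n → μ) ℂ) {L : Finset (Fin n → ι)}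
    {S : (Fin n → ι) → (Fin n → κ) → (Fin n → μ) → ℂ}
    (hS : ∀ u' v' w', S u' v' w' ≠ 0 → u' ∈ L) (v : Fin n → κ') (w : Fin n → μ') :
    (fun u => actTensor (powMat A n) B' C' S u v w) ∈ commutantSpan ι' L := by
  have hexp : (fun u => actTensor (powMat A n) B' C' S u v w) =
      ∑ u', (∑ v', ∑ w', B' v v' * C' w w' * S u' v' w') • fun u => powMat A n u u' := by
    funext u
    simp only [actTensor_apply, Finset.sum_apply, Pi.smul_apply, smul_eq_mul, Finset.sum_mul]
    refine Finset.sum_congr rfl fun u' _ => Finset.sum_congr rfl fun v' _ =>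
      Finset.sum_congr rfl fun w' _ => ?_
    ring
  rw [hexp]
  refine Submodule.sum_mem _ fun u' _ => ?_
  by_cases hu' : u' ∈ L
  · exact Submodule.smul_mem _ _ ((IsPermInvariant.powMat A n).col_mem_commutantSpan hu')
  · have h0 : ∑ v', ∑ w', B' v v' * C' w w' * S u' v' w' = 0 := by
      refine Finset.sum_eq_zero fun v' _ => Finset.sum_eq_zero fun w' _ => ?_
      have : S u' v' w' = 0 := by
        by_contra hne
        exact hu' (hS u' v' w' hne)
      rw [this, mul_zero]
    rw [h0, zero_smul]
    exact Submodule.zero_mem _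

/-- **Leg 2**: if `S` is supported on word triples whose second word lies in `L`, then every leg-2
column of `(A' ⊗ B^{⊗n} ⊗ C')·S` lies in `𝒲(L)`. [folklore] -/
theorem col_mem_commutantSpan₂ [Fintype κ'] [DecidableEq κ] [DecidableEq κ']
    (A' : Matrix (Fin n → ι') (Fin n → ι) ℂ) (B : Matrix κ' κ ℂ)
    (C' : Matrix (Fin n → μ') (Fin n → μ) ℂ) {L : Finset (Fin n → κ)}
    {S : (Fin n → ι) → (Fin n → κ) → (Fin n → μ) → ℂ}
    (hS : ∀ u' v' w', S u' v' w' ≠ 0 → v' ∈ L) (u : Fin n → ι') (w : Fin n → μ') :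
    (fun v => actTensor A' (powMat B n) C' S u v w) ∈ commutantSpan κ' L := by
  have hexp : (fun v => actTensor A' (powMat B n) C' S u v w) =
      ∑ v', (∑ u', ∑ w', A' u u' * C' w w' * S u' v' w') • fun v => powMat B n v v' := by
    funext v
    simp only [actTensor_apply, Finset.sum_apply, Pi.smul_apply, smul_eq_mul, Finset.sum_mul]
    rw [Finset.sum_comm]
    refine Finset.sum_congr rfl fun v' _ => Finset.sum_congr rfl fun u' _ =>
      Finset.sum_congr rfl fun w' _ => ?_
    ring
  rw [hexp]
  refine Submodule.sum_mem _ fun v' _ => ?_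
  by_cases hv' : v' ∈ L
  · exact Submodule.smul_mem _ _ ((IsPermInvariant.powMat B n).col_mem_commutantSpan hv')
  · have h0 : ∑ u', ∑ w', A' u u' * C' w w' * S u' v' w' = 0 := by
      refine Finset.sum_eq_zero fun u' _ => Finset.sum_eq_zero fun w' _ => ?_
      have : S u' v' w' = 0 := by
        by_contra hne
        exact hv' (hS u' v' w' hne)
      rw [this, mul_zero]
    rw [h0, zero_smul]
    exact Submodule.zero_mem _

/-- **Leg 3**: if `S` is supported on word triples whose third word lies in `L`, then every leg-3
column of `(A' ⊗ B' ⊗ C^{⊗n})·S` lies in `𝒲(L)`. [folklore] -/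
theorem col_mem_commutantSpan₃ [Fintype μ'] [DecidableEq μ] [DecidableEq μ']
    (A' : Matrix (Fin n → ι') (Fin n → ι) ℂ) (B' : Matrix (Fin n → κ') (Fin n → κ) ℂ) (C : Matrix μ' μ ℂ)
    {L : Finset (Fin n → μ)}
    {S : (Fin n → ι) → (Fin n → κ) → (Fin n → μ) → ℂ}
    (hS : ∀ u' v' w', S u' v' w' ≠ 0 → w' ∈ L) (u : Fin n → ι') (v : Fin n → κ') :
    (fun w => actTensor A' B' (powMat C n) S u v w) ∈ commutantSpan μ' L := by
  have hexp : (fun w => actTensor A' B' (powMat C n) S u v w) =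
      ∑ w', (∑ u', ∑ v', A' u u' * B' v v' * S u' v' w') • fun w => powMat C n w w' := by
    funext w
    simp only [actTensor_apply, Finset.sum_apply, Pi.smul_apply, smul_eq_mul, Finset.sum_mul]
    calc ∑ u', ∑ v', ∑ w', A' u u' * B' v v' * powMat C n w w' * S u' v' w'
        = ∑ u', ∑ w', ∑ v', A' u u' * B' v v' * powMat C n w w' * S u' v' w' :=
          Finset.sum_congr rfl fun u' _ => Finset.sum_comm
      _ = ∑ w', ∑ u', ∑ v', A' u u' * B' v v' * powMat C n w w' * S u' v' w' := Finset.sum_comm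
      _ = ∑ w', ∑ u', ∑ v', A' u u' * B' v v' * S u' v' w' * powMat C n w w' :=
          Finset.sum_congr rfl fun w' _ => Finset.sum_congr rfl fun u' _ =>
            Finset.sum_congr rfl fun v' _ => by ring
  rw [hexp]
  refine Submodule.sum_mem _ fun w' _ => ?_
  by_cases hw' : w' ∈ L
  · exact Submodule.smul_mem _ _ ((IsPermInvariant.powMat C n).col_mem_commutantSpan hw')
  · have h0 : ∑ u', ∑ v', A' u u' * B' v v' * S u' v' w' = 0 := by
      refine Finset.sum_eq_zero fun u' _ => Finset.sum_eq_zero fun v' _ => ?_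
      have : S u' v' w' = 0 := by
        by_contra hne
        exact hw' (hS u' v' w' hne)
      rw [this, mul_zero]
    rw [h0, zero_smul]
    exact Submodule.zero_mem _

end Columns

section LegFix

variable {α β γ : Type*} [Fintype α] [Fintype β] [Fintype γ]

/-- A matrix fixing all leg-1 columns of `X` fixes `X` when acting on leg 1. [folklore] -/
theorem actTensor_leg₁_eq_self [DecidableEq β] [DecidableEq γ] {P : Matrix α α ℂ}
    {W : Submodule ℂ (α → ℂ)} (hfix : ∀ f ∈ W, P *ᵥ f = f) {X : α → β → γ → ℂ}
    (hcol : ∀ b c, (fun a => X a b c) ∈ W) :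
    actTensor P (1 : Matrix β β ℂ) (1 : Matrix γ γ ℂ) X = X := by
  funext a b c
  rw [actTensor_leg₁_apply, hfix _ (hcol b c)]

/-- A matrix fixing all leg-2 columns of `X` fixes `X` when acting on leg 2. [folklore] -/
theorem actTensor_leg₂_eq_self [DecidableEq α] [DecidableEq γ] {P : Matrix β β ℂ}
    {W : Submodule ℂ (β → ℂ)} (hfix : ∀ f ∈ W, P *ᵥ f = f) {X : α → β → γ → ℂ}
    (hcol : ∀ a c, (fun b => X a b c) ∈ W) :
    actTensor (1 : Matrix α α ℂ) P (1 : Matrix γ γ ℂ) X = X := by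
  funext a b c
  rw [actTensor_leg₂_apply, hfix _ (hcol a c)]

/-- A matrix fixing all leg-3 columns of `X` fixes `X` when acting on leg 3. [folklore] -/
theorem actTensor_leg₃_eq_self [DecidableEq α] [DecidableEq β] {P : Matrix γ γ ℂ}
    {W : Submodule ℂ (γ → ℂ)} (hfix : ∀ f ∈ W, P *ᵥ f = f) {X : α → β → γ → ℂ}
    (hcol : ∀ a b, (fun c => X a b c) ∈ W) :
    actTensor (1 : Matrix α α ℂ) (1 : Matrix β β ℂ) P X = X := by
  funext a b c
  rw [actTensor_leg₃_apply, hfix _ (hcol a b)]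

end LegFix


/-! ## The core inequality `H_θ((A ⊗ B ⊗ C)·s) ≤ H_θ(supp s)` -/

section Core

variable {ι κ μ ι' κ' μ' : Type*} [Fintype ι'] [Fintype κ'] [Fintype μ']

/-- The normalised marginal spectrum recovers the eigenvalues: `λᵢ = ‖x‖² rᵢ` (leg 1). [folklore] -/
theorem eigenvalues_eq_tensorNormSq_mul_marginalSpectrum₁ [DecidableEq ι'] {x : ι' → κ' → μ' → ℂ}
    (hx : x ≠ 0) (i : ι') :
    (isHermitian_reducedDensity₁ x).eigenvalues i = tensorNormSq x * marginalSpectrum₁ x i := by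
  rw [marginalSpectrum₁, mul_div_cancel₀ _ (tensorNormSq_pos hx).ne']

/-- The normalised marginal spectrum recovers the eigenvalues (leg 2). [folklore] -/
theorem eigenvalues_eq_tensorNormSq_mul_marginalSpectrum₂ [DecidableEq κ'] {x : ι' → κ' → μ' → ℂ}
    (hx : x ≠ 0) (i : κ') :
    (isHermitian_reducedDensity₂ x).eigenvalues i = tensorNormSq x * marginalSpectrum₂ x i := by
  rw [marginalSpectrum₂, mul_div_cancel₀ _ (tensorNormSq_pos hx).ne']

/-- The normalised marginal spectrum recovers the eigenvalues (leg 3). [folklore] -/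
theorem eigenvalues_eq_tensorNormSq_mul_marginalSpectrum₃ [DecidableEq μ'] {x : ι' → κ' → μ' → ℂ}
    (hx : x ≠ 0) (i : μ') :
    (isHermitian_reducedDensity₃ x).eigenvalues i = tensorNormSq x * marginalSpectrum₃ x i := by
  rw [marginalSpectrum₃, mul_div_cancel₀ _ (tensorNormSq_pos hx).ne']

/-- **Core inequality (elementary form of CVZ Thm. 3.34 + Thm. 3.24 in fixed bases).** For a nonzero
complex 3-tensor `s`, any matrices `A, B, C` (of any formats), and `θ ∈ P([3])`, the `θ`-weighted
quantum entropy of `(A ⊗ B ⊗ C)·s` is at most the maximal `θ`-weighted marginal Shannon entropy of a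
probability distribution on the support of `s`: `H_θ((A ⊗ B ⊗ C)·s) ≤ H_θ(supp s)`.
[cite: ChristandlVranaZuiddam2023, Thm. 3.34] -/
theorem quantumEntropy_actTensor_le_maxWeightedEntropy [Fintype ι] [Fintype κ] [Fintype μ]
    [DecidableEq ι] [DecidableEq κ] [DecidableEq μ] [DecidableEq ι'] [DecidableEq κ'] [DecidableEq μ']
    {θ : Fin 3 → ℝ} (hθ : θ ∈ stdSimplex ℝ (Fin 3)) (s : ι → κ → μ → ℂ) (A : Matrix ι' ι ℂ)
    (B : Matrix κ' κ ℂ) (C : Matrix μ' μ ℂ) :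
    quantumEntropy θ (actTensor A B C s) ≤ maxWeightedEntropy θ (tensorSupport s) := by
  classical
  set x := actTensor A B C s with hxdef
  by_cases hx0 : x = 0
  · rw [hx0, quantumEntropy_zero]
    exact maxWeightedEntropy_nonneg hθ.1 _
  by_contra hlt
  rw [not_le] at hlt
  -- the gap and the marginal entropies
  set M := maxWeightedEntropy θ (tensorSupport s) with hM
  set ε := quantumEntropy θ x - M with hε
  have hεpos : 0 < ε := sub_pos.2 hlt
  set r₁ := marginalSpectrum₁ x with hr₁def
  set r₂ := marginalSpectrum₂ x with hr₂def
  set r₃ := marginalSpectrum₃ x with hr₃def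
  set c₁ := shannonEntropy r₁ with hc₁
  set c₂ := shannonEntropy r₂ with hc₂
  set c₃ := shannonEntropy r₃ with hc₃
  have hq : quantumEntropy θ x = θ 0 * c₁ + θ 1 * c₂ + θ 2 * c₃ := rfl
  set N := tensorNormSq x with hNdef
  have hN : 0 < N := tensorNormSq_pos hx0
  have hr₁ : r₁ ∈ stdSimplex ℝ ι' := marginalSpectrum₁_mem_stdSimplex hx0
  have hr₂ : r₂ ∈ stdSimplex ℝ κ' := marginalSpectrum₂_mem_stdSimplex hx0
  have hr₃ : r₃ ∈ stdSimplex ℝ μ' := marginalSpectrum₃_mem_stdSimplex hx0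
  have hev₁ := eigenvalues_eq_tensorNormSq_mul_marginalSpectrum₁ hx0
  have hev₂ := eigenvalues_eq_tensorNormSq_mul_marginalSpectrum₂ hx0
  have hev₃ := eigenvalues_eq_tensorNormSq_mul_marginalSpectrum₃ hx0
  -- the low sets on the three legs of `s`
  set L₁ : ∀ n : ℕ, Finset (Fin n → ι) := fun n => Finset.univ.filter fun u =>
    shannonEntropy (fun i => (letterCount u i : ℝ) / n) ≤ c₁ - ε with hL₁
  set L₂ : ∀ n : ℕ, Finset (Fin n → κ) := fun n => Finset.univ.filter fun v =>
    shannonEntropy (fun i => (letterCount v i : ℝ) / n) ≤ c₂ - ε with hL₂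
  set L₃ : ∀ n : ℕ, Finset (Fin n → μ) := fun n => Finset.univ.filter fun w =>
    shannonEntropy (fun i => (letterCount w i : ℝ) / n) ≤ c₃ - ε with hL₃
  have hL₁c : ∀ n : ℕ, 0 < n → ((L₁ n).card : ℝ) ≤
      ((n : ℝ) + 1) ^ Fintype.card ι * Real.exp (n * Real.log 2 * (c₁ - ε)) :=
    fun n hn => card_filter_entropy_le hn _
  have hL₂c : ∀ n : ℕ, 0 < n → ((L₂ n).card : ℝ) ≤
      ((n : ℝ) + 1) ^ Fintype.card κ * Real.exp (n * Real.log 2 * (c₂ - ε)) :=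
    fun n hn => card_filter_entropy_le hn _
  have hL₃c : ∀ n : ℕ, 0 < n → ((L₃ n).card : ℝ) ≤
      ((n : ℝ) + 1) ^ Fintype.card μ * Real.exp (n * Real.log 2 * (c₃ - ε)) :=
    fun n hn => card_filter_entropy_le hn _
  -- the trace estimate on each leg, with `δ = 1/4`
  have hδ : (0 : ℝ) < 1 / 4 := by norm_num
  obtain ⟨n₁, hn₁⟩ := trace_proj_powMat_le (isHermitian_reducedDensity₁ x) hN hr₁ hev₁ hc₁.symm hεpos
    L₁ hL₁c hδ
  obtain ⟨n₂, hn₂⟩ := trace_proj_powMat_le (isHermitian_reducedDensity₂ x) hN hr₂ hev₂ hc₂.symm hεpos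
    L₂ hL₂c hδ
  obtain ⟨n₃, hn₃⟩ := trace_proj_powMat_le (isHermitian_reducedDensity₃ x) hN hr₃ hev₃ hc₃.symm hεpos
    L₃ hL₃c hδ
  -- a large `n`
  set n := max (max n₁ n₂) (max n₃ 1) with hndef
  have hnn₁ : n₁ ≤ n := le_trans (le_max_left _ _) (le_max_left _ _)
  have hnn₂ : n₂ ≤ n := le_trans (le_max_right _ _) (le_max_left _ _)
  have hnn₃ : n₃ ≤ n := le_trans (le_max_left _ _) (le_max_right _ _)
  have hnpos : 0 < n := lt_of_lt_of_le Nat.one_pos (le_trans (le_max_right _ _) (le_max_right _ _))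
  -- the orthogonal projections onto the three commutant spans
  obtain ⟨k₁, B₁, -, hB₁, hcol₁, hfix₁⟩ := exists_orthonormalFrame (commutantSpan ι' (L₁ n))
  obtain ⟨k₂, B₂, -, hB₂, hcol₂, hfix₂⟩ := exists_orthonormalFrame (commutantSpan κ' (L₂ n))
  obtain ⟨k₃, B₃, -, hB₃, hcol₃, hfix₃⟩ := exists_orthonormalFrame (commutantSpan μ' (L₃ n))
  set P₁ := B₁ * B₁ᴴ with hP₁
  set P₂ := B₂ * B₂ᴴ with hP₂
  set P₃ := B₃ * B₃ᴴ with hP₃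
  have hP₁h : P₁.IsHermitian := Matrix.isHermitian_mul_conjTranspose_self B₁
  have hP₂h : P₂.IsHermitian := Matrix.isHermitian_mul_conjTranspose_self B₂
  have hP₃h : P₃.IsHermitian := Matrix.isHermitian_mul_conjTranspose_self B₃
  have hP₁e : P₁ * P₁ = P₁ := frame_proj_mul_self hB₁
  have hP₂e : P₂ * P₂ = P₂ := frame_proj_mul_self hB₂
  have hP₃e : P₃ * P₃ = P₃ := frame_proj_mul_self hB₃
  have hP₁i : ∀ f, P₁ *ᵥ f ∈ commutantSpan ι' (L₁ n) := frame_proj_mulVec_mem hcol₁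
  have hP₂i : ∀ f, P₂ *ᵥ f ∈ commutantSpan κ' (L₂ n) := frame_proj_mulVec_mem hcol₂
  have hP₃i : ∀ f, P₃ *ᵥ f ∈ commutantSpan μ' (L₃ n) := frame_proj_mulVec_mem hcol₃
  have kl₁ := hn₁ n hnn₁ P₁ hP₁h hfix₁ hP₁i
  have kl₂ := hn₂ n hnn₂ P₂ hP₂h hfix₂ hP₂i
  have kl₃ := hn₃ n hnn₃ P₃ hP₃h hfix₃ hP₃i
  -- the tensor power of `s` and its split according to the first low leg
  set S := kroneckerPow s n with hSdef
  set low₁ : (Fin n → ι) → Prop := fun u =>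
    shannonEntropy (fun i => (letterCount u i : ℝ) / n) ≤ c₁ - ε with hlow₁
  set low₂ : (Fin n → κ) → Prop := fun v =>
    shannonEntropy (fun i => (letterCount v i : ℝ) / n) ≤ c₂ - ε with hlow₂
  set low₃ : (Fin n → μ) → Prop := fun w =>
    shannonEntropy (fun i => (letterCount w i : ℝ) / n) ≤ c₃ - ε with hlow₃
  -- every nonzero entry of `S` has a low leg
  have hlow : ∀ u v w, S u v w ≠ 0 → low₁ u ∨ low₂ v ∨ low₃ w := by
    intro u v w hne
    have hmem : ∀ m, (u m, v m, w m) ∈ tensorSupport s := fun m =>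
      (mem_tensorSupport s _).2 (apply_ne_zero_of_kroneckerPow_ne_zero hne m)
    have hQ := weightedEntropy_le_maxWeightedEntropy hθ.1 (empirical_mem_stdSimplex hnpos u v w)
      (support_empirical_subset hmem)
    rw [weightedEntropy_empirical] at hQ
    refine exists_low_leg hθ ?_
    have : M = θ 0 * c₁ + θ 1 * c₂ + θ 2 * c₃ - ε := by rw [hε, hq]; ring
    rw [← this]
    exact hQ
  set S₁ : (Fin n → ι) → (Fin n → κ) → (Fin n → μ) → ℂ := fun u v w =>
    if low₁ u then S u v w else 0 with hS₁
  set S₂ : (Fin n → ι) → (Fin n → κ) → (Fin n → μ) → ℂ := fun u v w =>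
    if ¬low₁ u ∧ low₂ v then S u v w else 0 with hS₂
  set S₃ : (Fin n → ι) → (Fin n → κ) → (Fin n → μ) → ℂ := fun u v w =>
    if ¬low₁ u ∧ ¬low₂ v then S u v w else 0 with hS₃
  have hsplit : S = S₁ + S₂ + S₃ := by
    funext u v w
    simp only [Pi.add_apply, hS₁, hS₂, hS₃]
    by_cases h1 : low₁ u <;> by_cases h2 : low₂ v <;> simp [h1, h2]
  have hS₁s : ∀ u v w, S₁ u v w ≠ 0 → u ∈ L₁ n := by
    intro u v w h
    rw [hS₁] at h
    simp only [ne_eq, ite_eq_right_iff, Classical.not_imp] at h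
    exact Finset.mem_filter.2 ⟨Finset.mem_univ _, h.1⟩
  have hS₂s : ∀ u v w, S₂ u v w ≠ 0 → v ∈ L₂ n := by
    intro u v w h
    rw [hS₂] at h
    simp only [ne_eq, ite_eq_right_iff, Classical.not_imp] at h
    exact Finset.mem_filter.2 ⟨Finset.mem_univ _, h.1.2⟩
  have hS₃s : ∀ u v w, S₃ u v w ≠ 0 → w ∈ L₃ n := by
    intro u v w h
    rw [hS₃] at h
    simp only [ne_eq, ite_eq_right_iff, Classical.not_imp] at h
    obtain ⟨⟨h1, h2⟩, hne⟩ := h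
    rcases hlow u v w hne with h | h | h
    · exact absurd h h1
    · exact absurd h h2
    · exact Finset.mem_filter.2 ⟨Finset.mem_univ _, h⟩
  -- the tensor power of `x` and its split
  set X := kroneckerPow x n with hXdef
  set X₁ := actTensor (powMat A n) (powMat B n) (powMat C n) S₁ with hX₁
  set X₂ := actTensor (powMat A n) (powMat B n) (powMat C n) S₂ with hX₂
  set X₃ := actTensor (powMat A n) (powMat B n) (powMat C n) S₃ with hX₃
  have hXsplit : X = X₁ + X₂ + X₃ := by
    rw [hXdef, hxdef, kroneckerPow_actTensor_powMat, ← hSdef, hsplit, actTensor_tensor_add,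
      actTensor_tensor_add]
  -- the projections fix the summands
  have f₁ : actTensor P₁ (1 : Matrix (Fin n → κ') (Fin n → κ') ℂ)
      (1 : Matrix (Fin n → μ') (Fin n → μ') ℂ) X₁ = X₁ :=
    actTensor_leg₁_eq_self hfix₁ fun v w =>
      col_mem_commutantSpan₁ A (powMat B n) (powMat C n) hS₁s v w
  have f₂ : actTensor (1 : Matrix (Fin n → ι') (Fin n → ι') ℂ) P₂
      (1 : Matrix (Fin n → μ') (Fin n → μ') ℂ) X₂ = X₂ :=
    actTensor_leg₂_eq_self hfix₂ fun u w =>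
      col_mem_commutantSpan₂ (powMat A n) B (powMat C n) hS₂s u w
  have f₃ : actTensor (1 : Matrix (Fin n → ι') (Fin n → ι') ℂ)
      (1 : Matrix (Fin n → κ') (Fin n → κ') ℂ) P₃ X₃ = X₃ :=
    actTensor_leg₃_eq_self hfix₃ fun u v =>
      col_mem_commutantSpan₃ (powMat A n) (powMat B n) C hS₃s u v
  -- the union bound
  have hub := tensorNormSq_le_sum_three_legs hP₁h hP₂h hP₃h hP₁e hP₂e hP₃e hXsplit f₁ f₂ f₃
  rw [hXdef, tensorNormSq_kroneckerPow, reducedDensity₁_kroneckerPow, reducedDensity₂_kroneckerPow,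
    reducedDensity₃_kroneckerPow] at hub
  -- contradiction: `N^n ≤ 3 N^n / 4`
  have hNn : 0 < N ^ n := pow_pos hN n
  linarith

end Core

/-! ## `E_θ ≤ ρ^θ`, `F_θ ≤ ζ^θ`, and the discharge of the named fact -/

section Discharge

variable {ι κ μ : Type*} [Fintype ι] [Fintype κ] [Fintype μ] [DecidableEq ι] [DecidableEq κ]
  [DecidableEq μ]

/-- `H_θ(g·t) ≤ H_θ(supp (h·t))` for all `g, h ∈ GL × GL × GL` (the core inequality applied to
`s = h·t` and `g h⁻¹`). [cite: ChristandlVranaZuiddam2023, Thm. 3.34] -/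
theorem quantumEntropy_gl_le_maxWeightedEntropy_gl {θ : Fin 3 → ℝ} (hθ : θ ∈ stdSimplex ℝ (Fin 3))
    (t : ι → κ → μ → ℂ) (g h : GL ι ℂ × GL κ ℂ × GL μ ℂ) :
    quantumEntropy θ (actTensor (g.1 : Matrix ι ι ℂ) (g.2.1 : Matrix κ κ ℂ) (g.2.2 : Matrix μ μ ℂ) t) ≤
      maxWeightedEntropy θ (tensorSupport (actTensor (h.1 : Matrix ι ι ℂ) (h.2.1 : Matrix κ κ ℂ)
        (h.2.2 : Matrix μ μ ℂ) t)) := by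
  have hgt : actTensor (g.1 : Matrix ι ι ℂ) (g.2.1 : Matrix κ κ ℂ) (g.2.2 : Matrix μ μ ℂ) t =
      actTensor ((g.1 * h.1⁻¹ : GL ι ℂ) : Matrix ι ι ℂ) ((g.2.1 * h.2.1⁻¹ : GL κ ℂ) : Matrix κ κ ℂ)
        ((g.2.2 * h.2.2⁻¹ : GL μ ℂ) : Matrix μ μ ℂ)
        (actTensor (h.1 : Matrix ι ι ℂ) (h.2.1 : Matrix κ κ ℂ) (h.2.2 : Matrix μ μ ℂ) t) := by
    rw [actTensor_actTensor]
    simp only [Units.val_mul, Matrix.mul_assoc, Units.inv_mul, Matrix.mul_one]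
  rw [hgt]
  exact quantumEntropy_actTensor_le_maxWeightedEntropy hθ _ _ _ _

/-- **CVZ Thm. 3.34 (with Thm. 3.24/3.30), logarithmic form**: `E_θ(t) ≤ ρ^θ(t)` for every
`θ ∈ P([3])` and every complex 3-tensor `t`. [cite: ChristandlVranaZuiddam2023, Thm. 3.34] -/
theorem logQuantumFunctional_le_logUpperSupportFunctional {θ : Fin 3 → ℝ}
    (hθ : θ ∈ stdSimplex ℝ (Fin 3)) (t : ι → κ → μ → ℂ) :
    logQuantumFunctional θ t ≤ logUpperSupportFunctional θ t := by
  refine ciSup_le fun g => le_ciInf fun h => ?_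
  exact quantumEntropy_gl_le_maxWeightedEntropy_gl hθ t g h

/-- **CVZ Thm. 3.34**: `F_θ(t) ≤ ζ^θ(t)`. [cite: ChristandlVranaZuiddam2023, Thm. 3.34] -/
theorem quantumFunctional_le_upperSupportFunctional {θ : Fin 3 → ℝ} (hθ : θ ∈ stdSimplex ℝ (Fin 3))
    (t : ι → κ → μ → ℂ) : quantumFunctional θ t ≤ upperSupportFunctional θ t := by
  by_cases ht : t = 0
  · subst ht
    rw [quantumFunctional_zero, upperSupportFunctional_zero]
  · rw [quantumFunctional_of_ne_zero θ ht, upperSupportFunctional, if_neg ht]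
    exact Real.rpow_le_rpow_of_exponent_le one_le_two
      (logQuantumFunctional_le_logUpperSupportFunctional hθ t)

end Discharge

/-- **Discharge of the named fact** `ChristandlVranaZuiddam2023_le_upperSupportFunctional`
(CVZ Thm. 3.34: the upper support functional dominates the quantum functional, `ρ^θ(t) ≥ E_θ(t)` and
`ζ^θ(t) ≥ F^θ(t)` for `θ ∈ P([3])` and every complex 3-tensor `t`).
[cite: ChristandlVranaZuiddam2023, Thm. 3.34] -/
theorem ChristandlVranaZuiddam2023_le_upperSupportFunctional_holds :
    ChristandlVranaZuiddam2023_le_upperSupportFunctional := by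
  intro θ hθ ι κ μ _ _ _ _ _ _ t
  exact ⟨logQuantumFunctional_le_logUpperSupportFunctional hθ t,
    quantumFunctional_le_upperSupportFunctional hθ t⟩

end Literature.Computability.AlgebraicComplexity
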